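import Summits.AtomisticToContinuum.HydrodynamicLimit.Theorems.CollisionIsometryCLTMacroClosureEngineDefs
import Summits.AtomisticToContinuum.HydrodynamicLimit.Theorems.CollisionIsometryCLTMacroClosureStubThermoLambda
import Summits.AtomisticToContinuum.HydrodynamicLimit.Theorems.CollisionIsometryCLTMacroClosureStubThermoFlux
import HarnessLib

/-!
# Sub-goal `engine_isentropic` of the lead's stub `stub_engine` (line `IdeatorTwoGen1Sketch`, crux
# `MacroClosure`, stmt-AtomisticToContinuum-14870): classical solutions in the chamber are isentropic

For a classical hs-Euler solution `(ρ, u, θ)` on `[0, T)` staying in the dilute chamber of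
`ThermoChamber η₃`, with conserved state field `U = Ucl ρ θ u` and entropy variables
`Λ = Lcl σ ρ θ u = Dη_σ(U)`, the total entropy `s ↦ ∫ₓ η_σ(U(s, x)) dx` is conserved on `[0, T)`:
`∫ₓ η_σ(U(s, x)) dx = ∫ₓ η_σ(U(0, x)) dx` for `0 ≤ s < T`.

Proof. (1) `η_σ` is `C^∞` on the OPEN chamber (clause 1 of `ThermoChamber`, `isOpen_chamber`) and
`U` is jointly smooth with values in the chamber, so the entropy density `g(s, x) = η_σ(U(s, x))` is
jointly smooth on `[0, T) × 𝕋³` and `d/ds ∫ₓ g = ∫ₓ ∂ₛg` within `[0, T)`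
(`IsSmoothSpaceTimeOn.hasDerivWithinAt_integral`). (2) Chain rule for the one-sided time
derivative: `∂ₛg = Dη_σ(U)(∂ₛU) = Λ(∂ₛU)` (`EngineIsentropic.timeDerivWithin_entropy`). (3) The Euler
equations in conservation form `∂ₛU = −Σⱼ ∂ⱼ(Fⱼ∘U)` (componentwise the `mass` / `momentum` /
`energy` equations, with `Fⱼ(U) = (ρuⱼ, ρuⱼ u + p eⱼ, (E + p)uⱼ)`, `∇p = Σⱼ ∂ⱼp eⱼ`, the pressure
slice being smooth because `F₀` is smooth on the chamber) and integration by parts against the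
smooth operator field `Λ` give `∫ₓ Λ·∂ₛU = ∫ₓ Σⱼ ∂ⱼΛ·Fⱼ(U)`, which vanishes by the last identity of
clause 3 of `ThermoChamber` (entropy-flux compatibility)
(`EngineIsentropic.integral_Lambda_dtU_eq_zero`). (4) Hence `s ↦ ∫ₓ g(s, ·)` is continuous on
`[0, s]` with vanishing right derivative on `[0, s)`, so it is constant
(`constant_of_has_deriv_right_zero`).

The conservation form and the integration by parts follow the sibling sub-goal `engine_classical`
(`…EngineClassical.lean`, namespace `Barycentric.EngineClassical`).
-/

noncomputable section

open MeasureTheory Filter Set Topology InformationTheory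
open scoped ENNReal ContDiff

namespace Summit.AtomisticToContinuum.HydrodynamicLimit.Theorems.MacroClosureLine

open Literature.MathematicalPhysics.KineticTheory Literature.Analysis.FluidPDE
open Literature.Analysis.FunctionSpaces

namespace Barycentric

namespace EngineIsentropic

/-! ## Torus calculus: integration by parts against an operator field -/

section Calculus

variable {E' : Type*} [NormedAddCommGroup E'] [NormedSpace ℝ E']

/-- **Integration by parts against an operator field, one direction at a time.** For smooth
`L : 𝕋³ → (E' →L ℝ)` and smooth `G : 𝕋³ → E'`, `∫ ∂ⱼL·G = −∫ L·∂ⱼG` (Leibniz along the `j`-th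
coordinate line and `∫ ∂ⱼ(L·G) = 0` on the torus). -/
theorem integral_partialDeriv_clm_apply {L : T3 → (E' →L[ℝ] ℝ)} {G : T3 → E'}
    (hL : Torus.IsSmooth L) (hG : Torus.IsSmooth G) (j : Fin 3) :
    ∫ x, Torus.partialDeriv j L x (G x) = -∫ x, L x (Torus.partialDeriv j G x) := by
  have hL1 : Torus.IsContDiff 1 L := hL.isContDiff (by simp)
  have hG1 : Torus.IsContDiff 1 G := hG.isContDiff (by simp)
  have hLG1 : Torus.IsContDiff 1 (fun y => L y (G y)) := ContDiff.clm_apply hL1 hG1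
  have hiA : Torus.IsSmooth (fun y => Torus.partialDeriv j L y (G y)) :=
    ContDiff.clm_apply (hL.partialDeriv j) hG
  have hiB : Torus.IsSmooth (fun y => L y (Torus.partialDeriv j G y)) :=
    ContDiff.clm_apply hL (hG.partialDeriv j)
  -- Leibniz rule along the `j`-th coordinate line
  have hleib : ∀ x, Torus.partialDeriv j (fun y => L y (G y)) x =
      Torus.partialDeriv j L x (G x) + L x (Torus.partialDeriv j G x) := by
    intro x
    have h :=
      (Torus.hasDerivAt_comp_add_proj_smul hL1 x (EuclideanSpace.single j (1 : ℝ)) 0).clm_apply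
        (Torus.hasDerivAt_comp_add_proj_smul hG1 x (EuclideanSpace.single j (1 : ℝ)) 0)
    simp only [zero_smul, Torus.proj_zero, add_zero] at h
    exact h.deriv
  have h0 : ∫ x, Torus.partialDeriv j (fun y => L y (G y)) x = 0 :=
    Torus.integral_partialDeriv_eq_zero_of_isContDiff hLG1 j
  simp_rw [hleib] at h0
  rw [integral_add hiA.integrable hiB.integrable] at h0
  linarith

end Calculus

/-! ## The classical solution in the chamber -/

section Solution

variable {σ η₃ T : ℝ} {ρ θ : ℝ → T3 → ℝ} {u : ℝ → T3 → V3}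

/-- The space–time lift of the classical state field maps `[0, T) × ℝ³` into the chamber. -/
theorem mapsTo_stLift_Ucl (hE : IsHardSphereEulerSolution σ T ρ u θ)
    (hpack : ∀ s ∈ Ico 0 T, ∀ x, ρ s x * σ ^ 3 < η₃) :
    MapsTo (Torus.stLift (Ucl ρ θ u)) (Ico 0 T ×ˢ univ) (chamber σ η₃) := by
  rintro ⟨s, y⟩ hp
  have hs : s ∈ Ico 0 T := (mem_prod.1 hp).1
  exact stateOf_mem_chamber _ (hE.density_pos s hs _) (hE.temperature_pos s hs _) (hpack s hs _)

/-- **Chain rule for the entropy density along the classical solution**: if `η_σ` is smooth on a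
chamber containing the solution, then `∂ₛ[η_σ ∘ U_cl](s, x) = Λ_cl(s, x)(∂ₛU_cl(s, x))` on
`[0, T) × 𝕋³` (one-sided time derivatives within `[0, T)`). -/
theorem timeDerivWithin_entropy (hη : ContDiffOn ℝ ∞ (hsEntropy σ) (chamber σ η₃))
    (hE : IsHardSphereEulerSolution σ T ρ u θ) (hpack : ∀ s ∈ Ico 0 T, ∀ x, ρ s x * σ ^ 3 < η₃)
    {s : ℝ} (hs : s ∈ Ico 0 T) (x : T3) :
    Torus.timeDerivWithin (Ico 0 T) (fun τ y => hsEntropy σ (Ucl ρ θ u τ y)) s x =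
      Lcl σ ρ θ u s x (Torus.timeDerivWithin (Ico 0 T) (Ucl ρ θ u) s x) := by
  have hmem : Ucl ρ θ u s x ∈ chamber σ η₃ :=
    stateOf_mem_chamber (u s x) (hE.density_pos s hs x) (hE.temperature_pos s hs x) (hpack s hs x)
  have hd : HasFDerivAt (hsEntropy σ) (Lcl σ ρ θ u s x) (Ucl ρ θ u s x) :=
    ((hη.differentiableOn (by simp)).differentiableAt
      ((isOpen_chamber σ η₃).mem_nhds hmem)).hasFDerivAt
  have hU0 : Torus.IsSmoothSpaceTimeOn (Ico 0 T) (Ucl ρ θ u) := isSmoothSpaceTimeOn_stateOf hE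
  have hU : HasDerivWithinAt (fun τ => Ucl ρ θ u τ x)
      (Torus.timeDerivWithin (Ico 0 T) (Ucl ρ θ u) s x) (Ico 0 T) s :=
    hU0.hasDerivWithinAt_slice hs x
  exact (hd.comp_hasDerivWithinAt s hU).derivWithin (uniqueDiffOn_Ico 0 T s hs)

/-- The entropy density `η_σ ∘ U_cl` of a solution in the chamber of `ThermoChamber η₃` is jointly
smooth on `[0, T) × 𝕋³`. -/
theorem isSmoothSpaceTimeOn_entropy (hσ : 0 < σ) (hT : ThermoChamber η₃)
    (hE : IsHardSphereEulerSolution σ T ρ u θ) (hpack : ∀ s ∈ Ico 0 T, ∀ x, ρ s x * σ ^ 3 < η₃) :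
    Torus.IsSmoothSpaceTimeOn (Ico 0 T) (fun s x => hsEntropy σ (Ucl ρ θ u s x)) :=
  (hT σ hσ).1.1.comp (isSmoothSpaceTimeOn_stateOf hE) (mapsTo_stLift_Ucl hE hpack)

/-- The fluxes `Fⱼ ∘ U_cl` of a solution in the chamber of `ThermoChamber η₃` are jointly smooth on
`[0, T) × 𝕋³`. -/
theorem isSmoothSpaceTimeOn_flux (hσ : 0 < σ) (hT : ThermoChamber η₃)
    (hE : IsHardSphereEulerSolution σ T ρ u θ) (hpack : ∀ s ∈ Ico 0 T, ∀ x, ρ s x * σ ^ 3 < η₃)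
    (j : Fin 3) :
    Torus.IsSmoothSpaceTimeOn (Ico 0 T) (fun s x => eulerFlux σ j (Ucl ρ θ u s x)) :=
  ((hT σ hσ).1.2 j).comp (isSmoothSpaceTimeOn_stateOf hE) (mapsTo_stLift_Ucl hE hpack)

/-- **The pressure field `p = hsPressure σ ρ θ` of a solution in the chamber of `ThermoChamber η₃`
is jointly smooth on `[0, T) × 𝕋³`**: `p(U) = (F₀(U)).m₀ − m₀²/ρ` is a smooth function of the
state on the chamber (clause 1). -/
theorem isSmoothSpaceTimeOn_pressure (hσ : 0 < σ) (hT : ThermoChamber η₃)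
    (hE : IsHardSphereEulerSolution σ T ρ u θ) (hpack : ∀ s ∈ Ico 0 T, ∀ x, ρ s x * σ ^ 3 < η₃) :
    Torus.IsSmoothSpaceTimeOn (Ico 0 T) (fun s y => hsPressure σ (ρ s y) (θ s y)) := by
  have hF0 : ContDiffOn ℝ ∞ (eulerFlux σ 0) (chamber σ η₃) := (hT σ hσ).1.2 0
  have h1 : ContDiff ℝ ∞ fun U : State => U.1 := contDiff_fst
  have h2 : ContDiff ℝ ∞ fun U : State => U.2.1 0 :=
    (EuclideanSpace.proj (0 : Fin 3) : V3 →L[ℝ] ℝ).contDiff.comp (contDiff_fst.comp contDiff_snd)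
  have h3 : ContDiffOn ℝ ∞ (fun U : State => (eulerFlux σ 0 U).2.1 0) (chamber σ η₃) :=
    ((EuclideanSpace.proj (0 : Fin 3) : V3 →L[ℝ] ℝ).contDiff.comp
      (contDiff_fst.comp contDiff_snd)).comp_contDiffOn hF0
  have hq : ContDiffOn ℝ ∞ (fun U : State => (eulerFlux σ 0 U).2.1 0 - U.2.1 0 / U.1 * U.2.1 0)
      (chamber σ η₃) :=
    h3.sub ((h2.contDiffOn.div h1.contDiffOn fun U hU => hU.1.ne').mul h2.contDiffOn)
  -- `p(U) = (F₀(U)).m₀ − m₀²/ρ`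
  have hpU : ∀ U : State,
      hsPressure σ U.1 (stateTemp U) = (eulerFlux σ 0 U).2.1 0 - U.2.1 0 / U.1 * U.2.1 0 := by
    intro U
    simp only [eulerFlux, PiLp.add_apply, PiLp.smul_apply, smul_eq_mul, PiLp.single_apply, if_true,
      mul_one]
    ring
  have hP : ContDiffOn ℝ ∞ (fun U : State => hsPressure σ U.1 (stateTemp U)) (chamber σ η₃) :=
    hq.congr fun U _ => hpU U
  have hc : Torus.IsSmoothSpaceTimeOn (Ico 0 T)
      (fun s x => hsPressure σ (Ucl ρ θ u s x).1 (stateTemp (Ucl ρ θ u s x))) :=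
    hP.comp (isSmoothSpaceTimeOn_stateOf hE) (mapsTo_stLift_Ucl hE hpack)
  refine hc.congr ?_
  rintro ⟨s, y⟩ hp
  have hs : s ∈ Ico 0 T := (mem_prod.1 hp).1
  simp only [Torus.stLift_apply]
  rw [Ucl, stateOf_fst, stateTemp_stateOf (hE.density_pos s hs _).ne']

/-- **The Euler equations in conservation form** for a solution in the chamber of
`ThermoChamber η₃`, as an identity of `State`-valued fields:
`∂ₛU_cl(s, x) = −Σⱼ ∂ⱼ[x ↦ Fⱼ(U_cl(s, x))]` on `[0, T) × 𝕋³` (one-sided time derivative).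
Componentwise these are the `mass`, `momentum` (with `∇p = Σⱼ ∂ⱼp eⱼ`) and `energy` equations of
`IsHardSphereEulerSolution`; the pressure slice is smooth by `isSmoothSpaceTimeOn_pressure`. -/
theorem timeDerivWithin_Ucl_eq (hσ : 0 < σ) (hT : ThermoChamber η₃)
    (hE : IsHardSphereEulerSolution σ T ρ u θ) (hpack : ∀ s ∈ Ico 0 T, ∀ x, ρ s x * σ ^ 3 < η₃)
    {s : ℝ} (hs : s ∈ Ico 0 T) (x : T3) :
    Torus.timeDerivWithin (Ico 0 T) (Ucl ρ θ u) s x =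
      -∑ j, Torus.partialDeriv j (fun y => eulerFlux σ j (Ucl ρ θ u s y)) x := by
  have hS : UniqueDiffOn ℝ (Ico (0 : ℝ) T) := uniqueDiffOn_Ico 0 T
  have hp1 : Torus.IsContDiff 1 (fun y => hsPressure σ (ρ s y) (θ s y)) :=
    ((isSmoothSpaceTimeOn_pressure hσ hT hE hpack).isSmooth_slice hs).isContDiff (by simp)
  -- derivatives along coordinate lines (vector-valued)
  have hline : ∀ {G : Type} [NormedAddCommGroup G] [NormedSpace ℝ G] {f : T3 → G},
      Torus.IsContDiff 1 f → ∀ i : Fin 3,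
      HasDerivAt (fun r : ℝ => f (x + Torus.proj (r • EuclideanSpace.single i (1 : ℝ))))
        (Torus.partialDeriv i f x) 0 := by
    intro G _ _ f hf i
    have h := Torus.hasDerivAt_comp_add_proj_smul hf x (EuclideanSpace.single i (1 : ℝ)) 0
    simp only [zero_smul, Torus.proj_zero, add_zero] at h
    exact h
  -- the three balance laws at `(s, x)`
  have hmass := hE.mass s hs x
  have hmom := hE.momentum s hs x
  have hen := hE.energy s hs x
  simp only [Torus.divergence, PiLp.smul_apply, smul_eq_mul] at hmass hen
  -- jointly smooth building blocks
  have hρ := hE.smooth_density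
  have hu := hE.smooth_velocity
  have hU : Torus.IsSmoothSpaceTimeOn (Ico 0 T) (Ucl ρ θ u) := isSmoothSpaceTimeOn_stateOf hE
  have hm : Torus.IsSmoothSpaceTimeOn (Ico 0 T) (fun s y => ρ s y • u s y) := hρ.smul hu
  have hEn : Torus.IsSmoothSpaceTimeOn (Ico 0 T)
      (fun s y => totalEnergyDensity (ρ s y) (u s y) (θ s y)) :=
    (hU.clm_comp (ContinuousLinearMap.snd ℝ ℝ (V3 × ℝ))).clm_comp (ContinuousLinearMap.snd ℝ V3 ℝ)
  have hρ1 : Torus.IsContDiff 1 (ρ s) := (hρ.isSmooth_slice hs).isContDiff (by simp)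
  have hu1 : Torus.IsContDiff 1 (u s) := (hu.isSmooth_slice hs).isContDiff (by simp)
  have hEn1 : Torus.IsContDiff 1 (fun y => totalEnergyDensity (ρ s y) (u s y) (θ s y)) :=
    (hEn.isSmooth_slice hs).isContDiff (by simp)
  have huj1 : ∀ j, Torus.IsContDiff 1 (fun y => u s y j) := fun j =>
    HsEulerCalc.isContDiff_apply_coord hu1 j
  have hA1 : ∀ j, Torus.IsContDiff 1 (fun y => ρ s y * u s y j) := fun j =>
    ContDiff.mul hρ1 (huj1 j)
  have hB1 : ∀ j, Torus.IsContDiff 1 (fun y => (ρ s y * u s y j) • u s y) := fun j =>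
    ContDiff.smul (hA1 j) hu1
  have hC1 : ∀ j, Torus.IsContDiff 1 (fun y =>
      (totalEnergyDensity (ρ s y) (u s y) (θ s y) + hsPressure σ (ρ s y) (θ s y)) * u s y j) :=
    fun j => ContDiff.mul (ContDiff.add hEn1 hp1) (huj1 j)
  -- the flux slices in primitive variables
  have hfl : ∀ j, (fun y => eulerFlux σ j (Ucl ρ θ u s y)) = fun y =>
      (ρ s y * u s y j, (ρ s y * u s y j) • u s y +
        hsPressure σ (ρ s y) (θ s y) • EuclideanSpace.single j (1 : ℝ),
        (totalEnergyDensity (ρ s y) (u s y) (θ s y) + hsPressure σ (ρ s y) (θ s y)) * u s y j) := by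
    intro j
    funext y
    rw [Ucl, eulerFlux_stateOf σ (hE.density_pos s hs y).ne' (u s y) (θ s y) j]
    rfl
  -- the time derivative of `U_cl`, componentwise
  have hUt : Torus.timeDerivWithin (Ico 0 T) (Ucl ρ θ u) s x =
      (Torus.timeDerivWithin (Ico 0 T) ρ s x,
        Torus.timeDerivWithin (Ico 0 T) (fun s y => ρ s y • u s y) s x,
        Torus.timeDerivWithin (Ico 0 T) (fun s y => totalEnergyDensity (ρ s y) (u s y) (θ s y)) s x) :=
    ((hρ.hasDerivWithinAt_slice hs x).prodMk ((hm.hasDerivWithinAt_slice hs x).prodMk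
      (hEn.hasDerivWithinAt_slice hs x))).derivWithin (hS s hs)
  -- the partial derivatives of the flux slices, componentwise
  have hFx : ∀ j, Torus.partialDeriv j (fun y => eulerFlux σ j (Ucl ρ θ u s y)) x =
      (Torus.partialDeriv j (fun y => ρ s y * u s y j) x,
        Torus.partialDeriv j (fun y => (ρ s y * u s y j) • u s y) x +
          Torus.partialDeriv j (fun y => hsPressure σ (ρ s y) (θ s y)) x •
            EuclideanSpace.single j (1 : ℝ),
        Torus.partialDeriv j (fun y =>
          (totalEnergyDensity (ρ s y) (u s y) (θ s y) + hsPressure σ (ρ s y) (θ s y)) * u s y j) x) := by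
    intro j
    rw [hfl j]
    exact ((hline (hA1 j) j).prodMk (((hline (hB1 j) j).add ((hline hp1 j).smul_const _)).prodMk
      (hline (hC1 j) j))).deriv
  rw [hUt]
  simp only [hFx, ← prod_mk_sum, Finset.sum_add_distrib, Prod.neg_mk]
  rw [← Torus.gradient_eq_sum_partialDeriv hp1 x]
  refine Prod.ext ?_ (Prod.ext ?_ ?_)
  · linarith
  · exact eq_neg_of_add_eq_zero_left (by rw [← add_assoc]; exact hmom)
  · linarith

/-- **`∫ₓ Λ_cl·∂ₛU_cl = 0` in the chamber.** By the conservation form of the Euler equations and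
integration by parts against the smooth operator field `Λ`, `∫ₓ Λ·∂ₛU = ∫ₓ Σⱼ ∂ⱼΛ·Fⱼ(U)`, and the
right-hand side vanishes by the entropy-flux compatibility (last identity of clause 3 of
`ThermoChamber`). -/
theorem integral_Lambda_dtU_eq_zero (hσ : 0 < σ) (hT : ThermoChamber η₃)
    (hE : IsHardSphereEulerSolution σ T ρ u θ) (hpack : ∀ s ∈ Ico 0 T, ∀ x, ρ s x * σ ^ 3 < η₃)
    {s : ℝ} (hs : s ∈ Ico 0 T) :
    ∫ x, Lcl σ ρ θ u s x (Torus.timeDerivWithin (Ico 0 T) (Ucl ρ θ u) s x) = 0 := by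
  -- clause 3 of `ThermoChamber`: smoothness of `Λ` and the entropy-flux compatibility
  obtain ⟨hΛ0, -, -, hflux0⟩ := (hT σ hσ).2.2 T ρ θ u hE hpack
  have hΛ : Torus.IsSmoothSpaceTimeOn (Ico 0 T) (Lcl σ ρ θ u) := hΛ0
  have hflux :
      ∫ x, ∑ j, Torus.partialDeriv j (Lcl σ ρ θ u s) x (eulerFlux σ j (Ucl ρ θ u s x)) = 0 :=
    hflux0 s hs
  have hΛs : Torus.IsSmooth (Lcl σ ρ θ u s) := hΛ.isSmooth_slice hs
  have hFs : ∀ j, Torus.IsSmooth (fun y => eulerFlux σ j (Ucl ρ θ u s y)) := fun j =>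
    (isSmoothSpaceTimeOn_flux hσ hT hE hpack j).isSmooth_slice hs
  -- `∫ Λ·∂ₛU = -Σⱼ ∫ Λ·∂ⱼ(Fⱼ∘U) = Σⱼ ∫ ∂ⱼΛ·Fⱼ(U) = 0`
  have hsA : ∀ j, Torus.IsSmooth (fun x => Lcl σ ρ θ u s x
      (Torus.partialDeriv j (fun y => eulerFlux σ j (Ucl ρ θ u s y)) x)) := fun j =>
    ContDiff.clm_apply hΛs ((hFs j).partialDeriv j)
  have hsB : ∀ j, Torus.IsSmooth (fun x => Torus.partialDeriv j (Lcl σ ρ θ u s) x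
      (eulerFlux σ j (Ucl ρ θ u s x))) := fun j =>
    ContDiff.clm_apply (hΛs.partialDeriv j) (hFs j)
  have hparts : ∀ j,
      ∫ x, Torus.partialDeriv j (Lcl σ ρ θ u s) x (eulerFlux σ j (Ucl ρ θ u s x)) =
        -∫ x, Lcl σ ρ θ u s x
          (Torus.partialDeriv j (fun y => eulerFlux σ j (Ucl ρ θ u s y)) x) := fun j =>
    integral_partialDeriv_clm_apply hΛs (hFs j) j
  simp_rw [timeDerivWithin_Ucl_eq hσ hT hE hpack hs, map_neg, map_sum, integral_neg]
  rw [integral_finsetSum _ fun j _ => (hsA j).integrable]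
  rw [integral_finsetSum _ fun j _ => (hsB j).integrable] at hflux
  simp_rw [hparts] at hflux
  rw [Finset.sum_neg_distrib] at hflux
  linarith

/-- **The total entropy has vanishing one-sided derivative within `[0, T)`.** -/
theorem hasDerivWithinAt_integral_entropy (hσ : 0 < σ) (hT : ThermoChamber η₃)
    (hE : IsHardSphereEulerSolution σ T ρ u θ) (hpack : ∀ s ∈ Ico 0 T, ∀ x, ρ s x * σ ^ 3 < η₃)
    {s : ℝ} (hs : s ∈ Ico 0 T) :
    HasDerivWithinAt (fun τ => ∫ x, hsEntropy σ (Ucl ρ θ u τ x)) 0 (Ico 0 T) s := by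
  have hg := isSmoothSpaceTimeOn_entropy hσ hT hE hpack
  have h1 := hg.hasDerivWithinAt_integral (convex_Ico 0 T) hs
  have hpt : (fun x => Torus.timeDerivWithin (Ico 0 T)
      (fun τ y => hsEntropy σ (Ucl ρ θ u τ y)) s x) =
      fun x => Lcl σ ρ θ u s x (Torus.timeDerivWithin (Ico 0 T) (Ucl ρ θ u) s x) :=
    funext fun x => timeDerivWithin_entropy (hT σ hσ).1.1 hE hpack hs x
  rw [hpt, integral_Lambda_dtU_eq_zero hσ hT hE hpack hs] at h1
  exact h1

end Solution

end EngineIsentropic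

/-! ## The sub-goal -/

/-- **`engine_isentropic` (registered sub-goal of `stub_engine`): classical solutions in the chamber
are isentropic.** For a classical hs-Euler solution in the dilute chamber of `ThermoChamber η₃` and
`0 ≤ s < T`, `∫ₓ η_σ(U_cl(s, x)) dx = ∫ₓ η_σ(U_cl(0, x)) dx`: the entropy density is jointly smooth,
`∂ₛ η_σ(U) = Λ·∂ₛU` (chain rule), `∫ₓ Λ·∂ₛU = ∫ₓ Σⱼ ∂ⱼΛ·Fⱼ(U) = 0` (conservation form, integration
by parts, entropy-flux compatibility), so the total entropy has zero right derivative on `[0, T)`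
and is constant. -/
theorem engine_isentropic : ∀ (σ : ℝ), 0 < σ → ∀ (T : ℝ) (ρ θ : ℝ → T3 → ℝ) (u : ℝ → T3 → V3),
    IsHardSphereEulerSolution σ T ρ u θ → ∀ η₃ : ℝ, ThermoChamber η₃ →
    (∀ s ∈ Ico 0 T, ∀ x, ρ s x * σ ^ 3 < η₃) → ∀ s : ℝ, 0 ≤ s → s < T →
    ∫ x, hsEntropy σ (Ucl ρ θ u s x) = ∫ x, hsEntropy σ (Ucl ρ θ u 0 x) := by
  intro σ hσ T ρ θ u hE η₃ hT hpack s hs0 hsT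
  -- the entropy density is jointly smooth, so the total entropy is continuous on `[0, s]`
  have hg := EngineIsentropic.isSmoothSpaceTimeOn_entropy hσ hT hE hpack
  have hcont : ContinuousOn (fun τ => ∫ x, hsEntropy σ (Ucl ρ θ u τ x)) (Icc 0 s) :=
    (hg.continuousOn_integral (convex_Ico 0 T)).mono (Icc_subset_Ico_right hsT)
  -- zero right derivative on `[0, s)`
  have hright : ∀ τ ∈ Ico 0 s,
      HasDerivWithinAt (fun τ => ∫ x, hsEntropy σ (Ucl ρ θ u τ x)) 0 (Ici τ) τ := by
    intro τ hτ
    have hτT : τ ∈ Ico 0 T := ⟨hτ.1, hτ.2.trans hsT⟩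
    have h := EngineIsentropic.hasDerivWithinAt_integral_entropy hσ hT hE hpack hτT
    exact h.mono_of_mem_nhdsWithin
      (Filter.mem_of_superset (Ico_mem_nhdsGE hτT.2) (Ico_subset_Ico_left hτT.1))
  exact constant_of_has_deriv_right_zero hcont hright s (right_mem_Icc.2 hs0)

end Barycentric

end Summit.AtomisticToContinuum.HydrodynamicLimit.Theorems.MacroClosureLine

end
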